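import Literature.Analysis.FluidPDE.GCLMViscousSelfSimilarAnsatz
import Literature.Analysis.Fourier.HilbertTransformLineSplit
import HarnessLib

/-!
# SHEET-ℝ: a STRONG `C² ∩ L¹` zero of the certificate's profile map `G` is an exact self-similar VISCOUS gCLM blow-up
# (the typed target of the weak-to-classical bridge for the certified point `(a, c_l, ε) = (1/5, 1/2, 1)`)

HONEST FRAMING (cell ns-blowup GROUP B / zone Z3, case Z3-SR-CERT; 1-D MODEL (viscous gCLM/OSW on the line); not Euler/NS;
«violates: none — MODEL»). Nothing here asserts that a profile exists.

The certificate of record (cert-1, STATUS 2026-08-26 18:03Z; Lean transcript `CertificateViscousSheetR.lean`) produces an odd zero `Ω*` of the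
profile map

  `G(Ω) := Ω + ½ξΩ′ + a·𝒰Ω·Ω′ − (HΩ)·Ω − ε·Ω″`,  `𝒰Ω(ξ) = ∫₀^ξ HΩ`,  `H = Literature.Analysis.Fourier.hilbertTransform` (`H cos = sin`),

in the ENERGY space `E = odd H¹_{L²+ξ²}` and in the weak (`E*`) sense. The tree's blow-up theorem
`Literature.Analysis.FluidPDE.exact_viscous_selfSimilar_blowup_of_profile` wants instead a `C² ∩ L¹` profile solving the steady
dynamic-rescaling equation `ViscousGCLMProfileEqAt a ν Ω X` — written with the SPLIT-form operator `lineHilbert` and the velocity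
`lineVelocity` — at every `X`. This file is the dictionary between the two spellings for STRONG solutions: for `Ω ∈ C² ∩ L¹` the two Hilbert
transforms agree (`lineHilbert_eq_hilbertTransform_of_contDiff`), so `G(Ω) = 0` pointwise with `ε = ν` IS `ViscousGCLMProfileEqAt a ν Ω` at every point
(`viscousGCLMProfileEqAt_of_strongZero`), and hence (`exact_viscous_selfSimilar_blowup_of_strongZero`) every not-identically-zero `C² ∩ L¹`
strong zero of `G` yields, for every `T > 0`, a classical solution of `ω_t + a u ω_x = u_x ω + ν ω_xx` on `ℝ × [0,T)` blowing up at `T`.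
WHAT REMAINS between the certificate and this theorem is exactly the regularity bootstrap «`E`-weak zero ⇒ `C² ∩ L¹` strong zero» (the `L¹`
clause alone is `SheetRWeightedEmbeddings`' `E ⊂ L¹`); it is NOT in this file.
-/

noncomputable section

namespace Summit.NavierStokesRegularity.OSWSelfSimilar
namespace SheetRStrongZeroBlowup

open _root_.MeasureTheory _root_.Set _root_.Filter Literature.Analysis.Fourier Literature.Analysis.FluidPDE
open scoped Real Topology

/-- For `Ω ∈ C² ∩ L¹` the certificate's velocity `𝒰Ω(X) = ∫₀^X hilbertTransform Ω` is the gCLM velocity `lineVelocity Ω X`. [folklore] -/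
theorem lineVelocity_eq_integral_hilbertTransform {Ω : ℝ → ℝ} (hΩ2 : ContDiff ℝ 2 Ω) (hΩi : Integrable Ω) (X : ℝ) :
    lineVelocity Ω X = ∫ s in (0 : ℝ)..X, hilbertTransform Ω s := by
  rw [lineVelocity_def, lineHilbert_eq_hilbertTransform_of_contDiff (hΩ2.of_le (by norm_num)) hΩi]

/-- **Dictionary, strong form.** If `Ω ∈ C² ∩ L¹` is a pointwise zero of the certificate's profile map with viscosity `ν`,
`Ω(X) + ½X·Ω′(X) + a·(∫₀^X HΩ)·Ω′(X) − HΩ(X)·Ω(X) − ν·Ω″(X) = 0` (`H = hilbertTransform`, `Ω′ = deriv Ω`, `Ω″ = iteratedDeriv 2 Ω`),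
then `Ω` solves the steady dynamic-rescaling equation `ViscousGCLMProfileEqAt a ν Ω X`. [folklore] -/
theorem viscousGCLMProfileEqAt_of_strongZero {a ν : ℝ} {Ω : ℝ → ℝ} (hΩ2 : ContDiff ℝ 2 Ω) (hΩi : Integrable Ω) {X : ℝ}
    (hG : Ω X + 1 / 2 * X * deriv Ω X + a * (∫ s in (0 : ℝ)..X, hilbertTransform Ω s) * deriv Ω X
      - hilbertTransform Ω X * Ω X - ν * iteratedDeriv 2 Ω X = 0) :
    ViscousGCLMProfileEqAt a ν Ω X := by
  rw [viscousGCLMProfileEqAt_iff, lineVelocity_eq_integral_hilbertTransform hΩ2 hΩi,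
    lineHilbert_eq_hilbertTransform_of_contDiff (hΩ2.of_le (by norm_num)) hΩi]
  linear_combination hG

/-- Conversely, a `C² ∩ L¹` solution of `ViscousGCLMProfileEqAt a ν Ω X` is a pointwise zero of the certificate's map at `X`. [folklore] -/
theorem strongZero_of_viscousGCLMProfileEqAt {a ν : ℝ} {Ω : ℝ → ℝ} (hΩ2 : ContDiff ℝ 2 Ω) (hΩi : Integrable Ω) {X : ℝ}
    (hP : ViscousGCLMProfileEqAt a ν Ω X) :
    Ω X + 1 / 2 * X * deriv Ω X + a * (∫ s in (0 : ℝ)..X, hilbertTransform Ω s) * deriv Ω X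
      - hilbertTransform Ω X * Ω X - ν * iteratedDeriv 2 Ω X = 0 := by
  rw [viscousGCLMProfileEqAt_iff, lineVelocity_eq_integral_hilbertTransform hΩ2 hΩi,
    lineHilbert_eq_hilbertTransform_of_contDiff (hΩ2.of_le (by norm_num)) hΩi] at hP
  linear_combination hP

/-- **Typed target of the bridge.** A `C² ∩ L¹`, not identically zero, pointwise zero of the certificate's profile map
`G(Ω) = Ω + ½ξΩ′ + a𝒰Ω·Ω′ − (HΩ)Ω − νΩ″` (`H = hilbertTransform`, `𝒰Ω = ∫₀ HΩ`) gives, for every `T > 0`, an exact self-similar classical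
solution `ω(t,x) = (T − t)⁻¹Ω(x/√(T − t))` of the viscous gCLM `ω_t + a u ω_x = u_x ω + ν ω_xx` on `ℝ × [0,T)` whose sup norm blows up at `T`.
MODEL statement; no profile is asserted to exist — the certified `E`-ball zero of record is a WEAK zero, and the `E → C²` bootstrap is not here.
[folklore] -/
theorem exact_viscous_selfSimilar_blowup_of_strongZero {a ν T : ℝ} {Ω : ℝ → ℝ} (hT : 0 < T) (hΩ2 : ContDiff ℝ 2 Ω)
    (hΩi : Integrable Ω)
    (hG : ∀ X : ℝ, Ω X + 1 / 2 * X * deriv Ω X + a * (∫ s in (0 : ℝ)..X, hilbertTransform Ω s) * deriv Ω X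
      - hilbertTransform Ω X * Ω X - ν * iteratedDeriv 2 Ω X = 0)
    {X₀ : ℝ} (hX₀ : Ω X₀ ≠ 0) :
    IsGCLMLineSolution a ν (gclmSelfSimilar (-1) (1 / 2) T Ω) T ∧
      SupNormBlowupBefore (gclmSelfSimilar (-1) (1 / 2) T Ω) T :=
  exact_viscous_selfSimilar_blowup_of_profile hT hΩ2 hΩi
    (fun X => viscousGCLMProfileEqAt_of_strongZero hΩ2 hΩi (hG X)) hX₀

/-- The certified point's parameters: at `(a, ν) = (1/5, 1)` the hypothesis of the bridge target reads
`Ω + ½ξΩ′ + (1/5)·𝒰Ω·Ω′ − (HΩ)Ω − Ω″ = 0`, the map of `CertificateViscousSheetR.lean`. [folklore] -/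
theorem exact_viscous_selfSimilar_blowup_of_strongZero_fifth {T : ℝ} {Ω : ℝ → ℝ} (hT : 0 < T) (hΩ2 : ContDiff ℝ 2 Ω)
    (hΩi : Integrable Ω)
    (hG : ∀ X : ℝ, Ω X + 1 / 2 * X * deriv Ω X + 1 / 5 * (∫ s in (0 : ℝ)..X, hilbertTransform Ω s) * deriv Ω X
      - hilbertTransform Ω X * Ω X - iteratedDeriv 2 Ω X = 0)
    {X₀ : ℝ} (hX₀ : Ω X₀ ≠ 0) :
    IsGCLMLineSolution (1 / 5) 1 (gclmSelfSimilar (-1) (1 / 2) T Ω) T ∧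
      SupNormBlowupBefore (gclmSelfSimilar (-1) (1 / 2) T Ω) T :=
  exact_viscous_selfSimilar_blowup_of_strongZero hT hΩ2 hΩi (fun X => by rw [one_mul]; exact hG X) hX₀

end SheetRStrongZeroBlowup
end Summit.NavierStokesRegularity.OSWSelfSimilar
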